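import Summits.ResolutionOfSingularities.ResolutionOfSingularities.Theorems.HilbertSamuelEliminationSigmaMaxModificationsCorridor3WLadderIsoInsepE2NearCore
import Summits.ResolutionOfSingularities.ResolutionOfSingularities.Theorems.HilbertSamuelEliminationSigmaMaxModificationsCorridor3WLadderIsoTailsEmbeddedStep
import Literature.AlgebraicGeometry.Resolution.BlowupAlgebraPresentation
import HarnessLib

/-!
# [OURS · L1 W4.2] E2 chart calculus, brick 9: (N2′) IN THE CHART — at a point of `R[𝔪/c_j]` over `𝔪` where the strict transform
# of an E2-shaped `h ≡ ĉ(c_{i₀}² + λ̂c_{i₁}²) (mod 𝔪³)` lies in `𝔔²`, the fractions `c_{i₀}/c_j`, `c_{i₁}/c_j` lie in `𝔔`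
# (crux chain w42, cell k2 `T3insep` = `stub_isoInsepTower`; `--supports stmt-ResolutionOfSingularities-19249`)

OURS (cell res-hironaka, slot W4.2, seat res-D-pv-042; OWN OBJECT TUO 18:19Z); NOT a statement of [Hironaka2017] nor of
[CossartJannsenSaito2020] / [CossartPiltant2008]. AI-drafted, weaker than expert review. PROOF file, def-free, fact-free.

* `quotientSpanEquiv_mk_eval` / `_mk_algebraMap` / `_mk_frac` — values of the tree's `R[I/xᵢ]/(xᵢ) ≅ (R/I)[T_k : k ≠ i]`
  (`blowupAlgebra.quotientSpanEquiv`, Stacks 0BIQ) on `h(x/xᵢ)`, on `R` and on the fractions (LIB-CANDIDATEs).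
* `frac_mem_and_frac_mem_of_strictTransform_mem_sq` — **(N2′) in the chart**: `R` regular local with regular parameters
  `c : Fin d → R`, residue characteristic two (`2 ∈ 𝔪`), `h − ĉ(c_{i₀}² + λ̂c_{i₁}²) ∈ 𝔪³` (`ĉ` a unit, `λ̄` not a square,
  `i₀ ≠ i₁`), `𝔔` a prime of `B = R[𝔪/c_j]` over `𝔪` and `h = c_j²h′` in `B` with `h′ ∈ 𝔔²B_𝔔`; then `c_{i₀}/c_j, c_{i₁}/c_j ∈ 𝔔`
  (reduction modulo the exceptional generator: `B/c_jB ≅ κ[T_k : k ≠ j]` carries `h′` to `ĉ·(T_{i₀}² − λ̄T_{i₁}²)`, brick 8).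
-/

noncomputable section

set_option linter.dupNamespace false

open scoped Classical
open IsLocalRing MvPolynomial Literature.AlgebraicGeometry.Resolution
open Summit.ResolutionOfSingularities.ResolutionOfSingularities.Cruxes.SigmaMaxModifications.IdeasL1C5.EmbeddedStep
  (span_range_append_elim0 isMaximal_span_rsop isDomain_quotient_span_rsop)

namespace Summit.ResolutionOfSingularities.ResolutionOfSingularities.Cruxes.SigmaMaxModifications.IdeasL1C6.E2Chart

universe u

/-! ## §1. Values of `quotientSpanEquiv` -/

section Values

variable {R : Type u} [CommRing R] {r : ℕ} (x : Fin r → R) (i : Fin r) (hx : IsQuasiRegular x)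

/-- `quotientSpanEquiv` on the class of `h(x_j/xᵢ)` is the reduction of `h` modulo `I`. [folklore] -/
theorem quotientSpanEquiv_mk_eval (H : MvPolynomial {j : Fin r // j ≠ i} R) :
    blowupAlgebra.quotientSpanEquiv x i hx (Ideal.Quotient.mk _ (blowupAlgebra.eval x i H)) =
      MvPolynomial.map (Ideal.Quotient.mk (Ideal.span (Set.range x))) H := by
  unfold blowupAlgebra.quotientSpanEquiv
  simp only [RingEquiv.trans_apply]
  have h1 : (RingHom.quotientKerEquivOfSurjective (f := (Ideal.Quotient.mk (Ideal.span {algebraMap R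
      (blowupAlgebra (Ideal.span (Set.range x)) (x i)) (x i)})).comp (blowupAlgebra.eval x i).toRingHom)
      (Ideal.Quotient.mk_surjective.comp (blowupAlgebra.eval_surjective x i))).symm
      (Ideal.Quotient.mk _ (blowupAlgebra.eval x i H)) = Ideal.Quotient.mk _ H := by
    rw [RingEquiv.symm_apply_eq]
    rfl
  rw [h1, Ideal.quotEquivOfEq_mk, map_eq_eval₂Hom_C_comp]
  rfl

/-- `quotientSpanEquiv` on the class of `r ∈ R` is the constant `r̄`. [folklore] -/
theorem quotientSpanEquiv_mk_algebraMap (a : R) :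
    blowupAlgebra.quotientSpanEquiv x i hx (Ideal.Quotient.mk _
      (algebraMap R (blowupAlgebra (Ideal.span (Set.range x)) (x i)) a)) =
      C (Ideal.Quotient.mk (Ideal.span (Set.range x)) a) := by
  rw [← blowupAlgebra.eval_C x i a, quotientSpanEquiv_mk_eval, map_C]

/-- `quotientSpanEquiv` on the class of the fraction `x_j/xᵢ`, `j ≠ i`, is the variable `T_j`. [folklore] -/
theorem quotientSpanEquiv_mk_frac (j : {j : Fin r // j ≠ i}) :
    blowupAlgebra.quotientSpanEquiv x i hx (Ideal.Quotient.mk _ (blowupAlgebra.frac x i j.1)) = X j := by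
  rw [← blowupAlgebra.eval_X x i j, quotientSpanEquiv_mk_eval, map_X]

end Values

/-! ## §2. (N2′) in the chart -/

/-- **(N2′) IN THE CHART `R[𝔪/c_j]`.** Let `R` be a regular local ring of residue characteristic two (`2 ∈ 𝔪`) with regular
parameters `c : Fin d → R` (`(c) = 𝔪`, `d = μ(𝔪)`), and let `h ∈ R` have the E2 shape `h − ĉ·(c_{i₀}² + λ̂·c_{i₁}²) ∈ 𝔪³` with `ĉ` a
unit, `λ̄` not a square in the residue field and `i₀ ≠ i₁`. Let `𝔔` be a prime of the chart `B = R[𝔪/c_j]` lying over `𝔪` and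
`h′ ∈ B` with `h = c_j²·h′` (the strict transform). If `h′ ∈ 𝔔²B_𝔔` — the point `𝔔` of the blow-up is again a double point of the
strict transform — then **`c_{i₀}/c_j ∈ 𝔔` and `c_{i₁}/c_j ∈ 𝔔`**: the point lies on the line `V(x̄_{i₀}, x̄_{i₁})` of the exceptional
`ℙ^{d−1}` (in particular `j ∉ {i₀, i₁}`). Reduction modulo the exceptional generator (`B/c_jB ≅ κ[T_k : k ≠ j]`, Stacks 0BIQ) carries
`h′` to `c̄·(T_{i₀}² − λ̄T_{i₁}²)` (`T_j := 1`), and brick 8 applies. [OURS · L1 W4.2 · k2 · E2 chart calculus, brick 9] [folklore] -/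
theorem frac_mem_and_frac_mem_of_strictTransform_mem_sq {R : Type u} [CommRing R] [IsRegularLocalRing R] {d : ℕ}
    (hd : (maximalIdeal R).spanFinrank = d) (c : Fin d → R) (hc : Ideal.span (Set.range c) = maximalIdeal R)
    (h2 : (2 : R) ∈ maximalIdeal R) {i₀ i₁ : Fin d} (hne : i₀ ≠ i₁)
    {h cc lam : R} (hcc : cc ∉ maximalIdeal R) (hlam : ∀ u : R, u ^ 2 - lam ∉ maximalIdeal R)
    (hshape : h - cc * (c i₀ ^ 2 + lam * c i₁ ^ 2) ∈ maximalIdeal R ^ 3) (j : Fin d)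
    (𝔔 : Ideal (blowupAlgebra (Ideal.span (Set.range c)) (c j))) [𝔔.IsPrime]
    (h𝔔 : 𝔔.comap (algebraMap R (blowupAlgebra (Ideal.span (Set.range c)) (c j))) = maximalIdeal R)
    {h' : blowupAlgebra (Ideal.span (Set.range c)) (c j)}
    (hh' : algebraMap R (blowupAlgebra (Ideal.span (Set.range c)) (c j)) h =
      algebraMap R (blowupAlgebra (Ideal.span (Set.range c)) (c j)) (c j) ^ 2 * h')
    (hnear : algebraMap (blowupAlgebra (Ideal.span (Set.range c)) (c j)) (Localization.AtPrime 𝔔) h' ∈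
      maximalIdeal (Localization.AtPrime 𝔔) ^ 2) :
    blowupAlgebra.frac c j i₀ ∈ 𝔔 ∧ blowupAlgebra.frac c j i₁ ∈ 𝔔 := by
  -- the residue field `κ` (characteristic two) and the data read in it
  have hqr : IsQuasiRegular c := isQuasiRegular_centre c Fin.elim0 (span_range_append_elim0 c hc) hd
  have hres0 : ∀ a : R, residue R a = 0 ↔ a ∈ maximalIdeal R := fun a => Ideal.Quotient.eq_zero_iff_mem
  obtain ⟨μ, hμdef⟩ : ∃ μ : ResidueField R, μ = residue R lam := ⟨_, rfl⟩
  have hμ : ∀ b : ResidueField R, b ^ 2 ≠ μ := by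
    intro b hb
    obtain ⟨u, rfl⟩ := Ideal.Quotient.mk_surjective (I := maximalIdeal R) b
    apply hlam u
    rw [← hres0, map_sub, map_pow, ← hμdef]
    exact sub_eq_zero.mpr hb
  have hcc0 : residue R cc ≠ 0 := fun h0 => hcc ((hres0 cc).mp h0)
  have h2κ : (2 : ResidueField R) = 0 := by
    have := (hres0 2).mpr h2
    rwa [map_ofNat] at this
  -- the reduction `π : B → B/c_jB ≅ (R/(c))[T_k : k ≠ j] ≅ κ[T_k : k ≠ j]`
  obtain ⟨ρ, hρ⟩ : ∃ ρ : (R ⧸ Ideal.span (Set.range c)) ≃+* ResidueField R,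
      ∀ a : R, ρ (Ideal.Quotient.mk _ a) = residue R a :=
    ⟨Ideal.quotEquivOfEq hc, fun a => Ideal.quotEquivOfEq_mk _ _⟩
  obtain ⟨π, hπe, hπsurj⟩ : ∃ π : blowupAlgebra (Ideal.span (Set.range c)) (c j) →+* MvPolynomial {k : Fin d // k ≠ j} (ResidueField R),
      (∀ z, π z = MvPolynomial.map (ρ : (R ⧸ Ideal.span (Set.range c)) →+* ResidueField R)
        (blowupAlgebra.quotientSpanEquiv c j hqr
          (Ideal.Quotient.mk (Ideal.span {algebraMap R (blowupAlgebra (Ideal.span (Set.range c)) (c j)) (c j)}) z))) ∧ Function.Surjective π :=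
    ⟨(mapEquiv {k : Fin d // k ≠ j} ρ).toRingHom.comp
        ((blowupAlgebra.quotientSpanEquiv c j hqr).toRingHom.comp (Ideal.Quotient.mk _)),
      fun z => rfl,
      (mapEquiv {k : Fin d // k ≠ j} ρ).surjective.comp
        ((blowupAlgebra.quotientSpanEquiv c j hqr).surjective.comp Ideal.Quotient.mk_surjective)⟩
  have hπalg : ∀ a : R, π (algebraMap R (blowupAlgebra (Ideal.span (Set.range c)) (c j)) a) = C (residue R a) := fun a => by
    rw [hπe, quotientSpanEquiv_mk_algebraMap c j hqr a, map_C, RingEquiv.coe_toRingHom, hρ]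
  have hπfrac : ∀ (k : Fin d) (hk : k ≠ j), π (blowupAlgebra.frac c j k) = X ⟨k, hk⟩ := fun k hk => by
    rw [hπe, quotientSpanEquiv_mk_frac c j hqr ⟨k, hk⟩, map_X]
  have hfracj : blowupAlgebra.frac c j j = 1 := blowupAlgebra.gen_self _ _ _
  -- `c_j ∈ 𝔔` and `ker π = (c_j) ⊆ 𝔔`
  have hcj𝔔 : algebraMap R (blowupAlgebra (Ideal.span (Set.range c)) (c j)) (c j) ∈ 𝔔 := by
    have : c j ∈ 𝔔.comap (algebraMap R (blowupAlgebra (Ideal.span (Set.range c)) (c j))) := by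
      rw [h𝔔, ← hc]; exact Ideal.subset_span (Set.mem_range_self j)
    exact this
  have hkerle : RingHom.ker π ≤ 𝔔 := by
    intro z hz
    rw [RingHom.mem_ker, hπe, map_eq_zero_iff _ (MvPolynomial.map_injective _ ρ.injective),
      map_eq_zero_iff _ (blowupAlgebra.quotientSpanEquiv c j hqr).injective, Ideal.Quotient.eq_zero_iff_mem] at hz
    exact (Ideal.span_singleton_le_iff_mem _).mpr hcj𝔔 hz
  -- the prime `𝔭 = π(𝔔)` of `κ[T]` and the local map `B_𝔔 → κ[T]_𝔭`
  obtain ⟨𝔭, h𝔭⟩ : ∃ 𝔭 : Ideal (MvPolynomial {k : Fin d // k ≠ j} (ResidueField R)), 𝔭 = 𝔔.map π := ⟨_, rfl⟩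
  haveI h𝔭p : 𝔭.IsPrime := by rw [h𝔭]; exact Ideal.map_isPrime_of_surjective hπsurj hkerle
  have hcomap : 𝔭.comap π = 𝔔 := by
    rw [h𝔭, Ideal.comap_map_of_surjective π hπsurj, ← RingHom.ker_eq_comap_bot]
    exact sup_eq_left.mpr hkerle
  have hLh' : algebraMap (MvPolynomial {k : Fin d // k ≠ j} (ResidueField R)) (Localization.AtPrime 𝔭) (π h') ∈
      maximalIdeal (Localization.AtPrime 𝔭) ^ 2 := by
    have hloc := map_mem_maximalIdeal_sq (A := Localization.AtPrime 𝔔) (B := Localization.AtPrime 𝔭)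
      (Localization.localRingHom 𝔔 𝔭 π hcomap.symm) hnear
    rwa [Localization.localRingHom_to_map] at hloc
  -- the strict transform modulo `c_j`: `h′ = ĉ·(u² + λ̂v²) + c_j·r′`, `u = c_{i₀}/c_j`, `v = c_{i₁}/c_j`
  have hu' : algebraMap R (blowupAlgebra (Ideal.span (Set.range c)) (c j)) (c i₀) =
      algebraMap R (blowupAlgebra (Ideal.span (Set.range c)) (c j)) (c j) * blowupAlgebra.frac c j i₀ :=
    (blowupAlgebra.algebraMap_mul_gen _ _ (c i₀) (blowupAlgebra.mem_span_range c i₀)).symm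
  have hv' : algebraMap R (blowupAlgebra (Ideal.span (Set.range c)) (c j)) (c i₁) =
      algebraMap R (blowupAlgebra (Ideal.span (Set.range c)) (c j)) (c j) * blowupAlgebra.frac c j i₁ :=
    (blowupAlgebra.algebraMap_mul_gen _ _ (c i₁) (blowupAlgebra.mem_span_range c i₁)).symm
  obtain ⟨r', hr'⟩ : ∃ r' : blowupAlgebra (Ideal.span (Set.range c)) (c j),
      r' * algebraMap R (blowupAlgebra (Ideal.span (Set.range c)) (c j)) (c j) ^ 3 =
        algebraMap R (blowupAlgebra (Ideal.span (Set.range c)) (c j)) (h - cc * (c i₀ ^ 2 + lam * c i₁ ^ 2)) := by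
    have h3 : algebraMap R (blowupAlgebra (Ideal.span (Set.range c)) (c j)) (h - cc * (c i₀ ^ 2 + lam * c i₁ ^ 2)) ∈
        (Ideal.span (Set.range c) ^ 3).map (algebraMap R (blowupAlgebra (Ideal.span (Set.range c)) (c j))) := by
      apply Ideal.mem_map_of_mem; rwa [hc]
    rw [Ideal.map_pow, map_blowupAlgebra_eq_span (blowupAlgebra.mem_span_range c j), Ideal.span_singleton_pow] at h3
    exact Ideal.mem_span_singleton'.mp h3
  have hcj0 : algebraMap R (blowupAlgebra (Ideal.span (Set.range c)) (c j)) (c j) ^ 2 ∈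
      nonZeroDivisors (blowupAlgebra (Ideal.span (Set.range c)) (c j)) :=
    pow_mem algebraMap_mem_nonZeroDivisors_blowupAlgebra 2
  have hh'eq : h' = algebraMap R (blowupAlgebra (Ideal.span (Set.range c)) (c j)) cc *
        (blowupAlgebra.frac c j i₀ ^ 2 +
          algebraMap R (blowupAlgebra (Ideal.span (Set.range c)) (c j)) lam * blowupAlgebra.frac c j i₁ ^ 2) +
      algebraMap R (blowupAlgebra (Ideal.span (Set.range c)) (c j)) (c j) * r' := by
    apply (mul_cancel_left_mem_nonZeroDivisors hcj0).mp
    rw [← hh']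
    have : h = cc * (c i₀ ^ 2 + lam * c i₁ ^ 2) + (h - cc * (c i₀ ^ 2 + lam * c i₁ ^ 2)) := by ring
    rw [this, map_add, ← hr', map_mul, map_add, map_mul, map_pow, map_pow, hu', hv']
    ring
  -- its reduction: `π h′ = c̄·(A² + λ̄B²) = c̄·(A² − λ̄B²)` (characteristic two), `A = π u`, `B = π v`
  have hπh' : π h' = C (residue R cc) * (π (blowupAlgebra.frac c j i₀) ^ 2 - C μ * π (blowupAlgebra.frac c j i₁) ^ 2) := by
    have hneg : (C μ : MvPolynomial {k : Fin d // k ≠ j} (ResidueField R)) = -C μ := by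
      rw [eq_neg_iff_add_eq_zero, ← two_mul, ← map_ofNat C 2, ← map_mul, h2κ, zero_mul, map_zero]
    rw [hh'eq, map_add, map_mul, map_mul, hπalg (c j)]
    have : residue R (c j) = 0 := (hres0 (c j)).mpr (hc ▸ Ideal.subset_span (Set.mem_range_self j))
    rw [this, C_0, zero_mul, add_zero, hπalg, map_add, map_mul, map_pow, map_pow, hπalg, ← hμdef]
    rw [sub_eq_add_neg, ← neg_mul, ← hneg]
  -- so `A² − λ̄B² ∈ 𝔭²κ[T]_𝔭`
  have hmain : algebraMap (MvPolynomial {k : Fin d // k ≠ j} (ResidueField R)) (Localization.AtPrime 𝔭)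
      (π (blowupAlgebra.frac c j i₀) ^ 2 - C μ * π (blowupAlgebra.frac c j i₁) ^ 2) ∈ maximalIdeal (Localization.AtPrime 𝔭) ^ 2 := by
    rw [hπh', map_mul] at hLh'
    have hinv : algebraMap (MvPolynomial {k : Fin d // k ≠ j} (ResidueField R)) (Localization.AtPrime 𝔭) (C (residue R cc)⁻¹) *
        algebraMap (MvPolynomial {k : Fin d // k ≠ j} (ResidueField R)) (Localization.AtPrime 𝔭) (C (residue R cc)) = 1 := by
      rw [← map_mul, ← C_mul, inv_mul_cancel₀ hcc0, C_1, map_one]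
    have := Ideal.mul_mem_left _ (algebraMap (MvPolynomial {k : Fin d // k ≠ j} (ResidueField R)) (Localization.AtPrime 𝔭) (C (residue R cc)⁻¹)) hLh'
    rwa [← mul_assoc, hinv, one_mul] at this
  -- membership test through `π`
  have hmem_of : ∀ (k : Fin d) (hk : k ≠ j), (X ⟨k, hk⟩ : MvPolynomial {k : Fin d // k ≠ j} (ResidueField R)) ∈ 𝔭 →
      blowupAlgebra.frac c j k ∈ 𝔔 := by
    intro k hk hX
    rw [← hcomap, Ideal.mem_comap, hπfrac k hk]
    exact hX
  -- case analysis on the position of the chart index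
  by_cases hi₀ : i₀ = j
  · -- `u = 1`: the shape `1 − λ̄B²` is never in `𝔪²`
    exfalso
    have hi₁ : i₁ ≠ j := fun h => hne (hi₀.trans h.symm)
    have hA : π (blowupAlgebra.frac c j i₀) = 1 := by rw [hi₀, hfracj, map_one]
    rw [hA, one_pow, hπfrac i₁ hi₁] at hmain
    exact one_sub_C_mul_X_sq_not_mem_maximalIdeal_sq hμ (⟨i₁, hi₁⟩ : {k : Fin d // k ≠ j}) 𝔭 hmain
  by_cases hi₁ : i₁ = j
  · -- `v = 1`: the shape `A² − λ̄` is never in `𝔪²`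
    exfalso
    have hBv : π (blowupAlgebra.frac c j i₁) = 1 := by rw [hi₁, hfracj, map_one]
    rw [hBv, one_pow, mul_one, hπfrac i₀ hi₀] at hmain
    exact X_sq_sub_C_not_mem_maximalIdeal_sq hμ (⟨i₀, hi₀⟩ : {k : Fin d // k ≠ j}) 𝔭 hmain
  -- generic chart: brick 8
  rw [hπfrac i₀ hi₀, hπfrac i₁ hi₁] at hmain
  have hne' : (⟨i₀, hi₀⟩ : {k : Fin d // k ≠ j}) ≠ ⟨i₁, hi₁⟩ := fun h => hne (congrArg Subtype.val h)
  obtain ⟨h0, h1⟩ := X_mem_and_X_mem_of_mem_maximalIdeal_sq hμ hne' 𝔭 hmain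
  exact ⟨hmem_of i₀ hi₀ h0, hmem_of i₁ hi₁ h1⟩

end Summit.ResolutionOfSingularities.ResolutionOfSingularities.Cruxes.SigmaMaxModifications.IdeasL1C6.E2Chart

end
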